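import Summits.MatrixMultiplication.MatrixMultiplication.Theses.NonabelianARC
import Summits.MatrixMultiplication.MatrixMultiplication.Theorems.AsymptoticRankCWBPerm3Form
import Literature.Computability.AlgebraicComplexity.AsymptoticRankBorderRank
import Literature.Barriers.MatrixMultiplication.UniversalMethodBarrierAsymptoticRank

/-!
# Birth skeleton (BC3) for the split piece `JLadderHigherFlat` of crux `NAARCLadder`
(route `MatrixMultiplication/NonabelianARC`, parent item `stmt-MatrixMultiplication-4972`)

`JLadderHigherFlat : ∀ l ≥ 2, R̃(J_l) = 2l+1` for the route's inline `3j` tensors `J_l` (the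
ω-INDEPENDENT rungs of the NA-ARC ladder; `l = 2` is the route's rank-2 crux `ThreeJTwoFlat`).
Line of attack = the route's foreseen split "JTwoPowerDecay → BorderToAsymptotic" for every rung:
lower frame `2l+1 ≤ R̃(J_l)` by conciseness / flattening rank (`stub_lowerFrame`, = item
`LadderLowerFrame` for `l ≥ 2`, provable now), BORDER-RANK POWER DECAY `bR(J_l^{⊠N})^{1/N} → 2l+1`
(`stub_borderPowerDecay`, open; first datum wanted: `bR(J_2^{⊠2}) ≤ 63 < 64`, item
`JTwoSquareStrict`; tools: border apolarity for the `SL₂ × 𝔖_N`-symmetric powers, Koszul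
flattenings `bR(J_2) = 8`, `bR(J_3) ≥ 13` for the lower side), and the PROVED transfer
`R̃(t)^N ≤ R̃(t^{⊠N}) ≤ bR(t^{⊠N})`.

Stubs (sorried, registered): `stub_lowerFrame`, `stub_borderPowerDecay`.
The line's target by name, from the named stubs: `JLadderHigherFlat_proof`; composition with explicit
hypotheses (no sorry): `JLadderHigherFlat_of`.
-/

set_option linter.dupNamespace false

noncomputable section

open scoped BigOperators
open Filter Literature.Computability.AlgebraicComplexity
open Summit.MatrixMultiplication.MatrixMultiplication.Theorems
  (pow_asymptoticRank_le_asymptoticRank_kroneckerPow)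

namespace Summit.MatrixMultiplication.MatrixMultiplication.Cruxes.NAARCLadder.JLadderHigherFlatBirth

/-- The route's inline `3j` tensor (verbatim the `let J` of the route file; `= threeJTensor`). -/
def J (l : ℕ) : Fin (2 * l + 1) → Fin (2 * l + 1) → Fin (2 * l + 1) → ℂ :=
  fun a b c => if a.val + b.val + c.val = 3 * l then ∑ t ∈ Finset.range (l + 1), (if l ≤ t + b.val ∧ a.val ≤ t + l then (-1 : ℂ) ^ (t + a.val + b.val) * ((Nat.choose l t * Nat.choose l (t + b.val - l) * Nat.choose l (t + l - a.val) : ℕ) : ℂ) else 0) else 0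

/-- STUB (lower frame, provable now, size M): `2l + 1 ≤ R̃(J_l)` for `l ≥ 2` — `J_l` is concise
(its flattening `V_{2l} → V_{2l} ⊗ V_{2l}` is a non-zero `SL₂`-map from an irreducible module;
or check the explicit minors of the closed formula), and flattening rank bounds `R̃` below. This is
item `LadderLowerFrame` (stmt-MatrixMultiplication-4977) restricted to `l ≥ 2`. -/
theorem stub_lowerFrame : ∀ l : ℕ, 2 ≤ l → 2 * (l : ℝ) + 1 ≤ asymptoticRank (J l) := by
  sorry

/-- STUB (the constructive content, OPEN, size XL): BORDER-RANK POWER DECAY on every higher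
rung — for `l ≥ 2` and every `δ > 0` some Kronecker power of `J_l` has algebraic border rank
`≤ (2l + 1 + δ)^N` (NA-ARC's mechanism: the `SL₂`-symmetry of `J_l` propagates to `J_l^{⊠N}`;
first datum `bR(J_2^{⊠2}) ≤ 63`, item `JTwoSquareStrict`; `bR(J_2) = 8`, so decay must come from
powers). -/
theorem stub_borderPowerDecay : ∀ l : ℕ, 2 ≤ l → ∀ δ : ℝ, 0 < δ → ∃ N : ℕ, 1 ≤ N ∧
    (algBorderRank (kroneckerPow (J l) N) : ℝ) ≤ (2 * (l : ℝ) + 1 + δ) ^ N := by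
  sorry

/-- TRANSFER (proved): border-rank power decay at rate `ρ` forces `R̃(t) ≤ ρ`, since
`R̃(t)^N ≤ R̃(t^{⊠N}) ≤ bR(t^{⊠N}) ≤ (ρ + δ)^N` for the good `N`, so `R̃(t) ≤ ρ + δ` for every
`δ > 0`. [folklore] -/
theorem asymptoticRank_le_of_borderPowerDecay {ι κ μ : Type} [Fintype ι] [Fintype κ] [Fintype μ]
    [DecidableEq ι] [DecidableEq κ] [DecidableEq μ] (t : ι → κ → μ → ℂ) {ρ : ℝ} (hρ : 0 ≤ ρ)
    (h : ∀ δ : ℝ, 0 < δ → ∃ N : ℕ, 1 ≤ N ∧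
      (algBorderRank (kroneckerPow t N) : ℝ) ≤ (ρ + δ) ^ N) :
    asymptoticRank t ≤ ρ := by
  refine le_of_forall_pos_le_add fun δ hδ => ?_
  obtain ⟨N, hN, hb⟩ := h δ hδ
  have h0 : 0 ≤ asymptoticRank t := asymptoticRank_nonneg t
  have hpow : asymptoticRank t ^ N ≤ (ρ + δ) ^ N :=
    calc asymptoticRank t ^ N ≤ asymptoticRank (kroneckerPow t N) :=
          pow_asymptoticRank_le_asymptoticRank_kroneckerPow t hN
      _ ≤ algBorderRank (kroneckerPow t N) := asymptoticRank_le_algBorderRank _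
      _ ≤ (ρ + δ) ^ N := hb
  exact (pow_le_pow_iff_left₀ h0 (by linarith) (by omega)).1 hpow

/-- THE LINE (kernel-checked composition of the two REGISTERED stubs, by name): the route decl
`JLadderHigherFlat` (item `stmt-MatrixMultiplication-17870`). -/
theorem JLadderHigherFlat_proof :
    Summit.MatrixMultiplication.MatrixMultiplication.Theses.NonabelianARC.JLadderHigherFlat := by
  unfold Summit.MatrixMultiplication.MatrixMultiplication.Theses.NonabelianARC.JLadderHigherFlat
  intro J' l hl
  show asymptoticRank (J l) = 2 * (l : ℝ) + 1
  exact le_antisymm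
    (asymptoticRank_le_of_borderPowerDecay (J l) (by positivity) (stub_borderPowerDecay l hl))
    (stub_lowerFrame l hl)

/-- COMPOSITION with the stubs as explicit hypotheses (BC3 shape, no sorry): lower frame and
border power decay on every rung `l ≥ 2` give the piece `JLadderHigherFlat`. -/
theorem JLadderHigherFlat_of :
    (∀ l : ℕ, 2 ≤ l → 2 * (l : ℝ) + 1 ≤ asymptoticRank (J l)) →
    (∀ l : ℕ, 2 ≤ l → ∀ δ : ℝ, 0 < δ → ∃ N : ℕ, 1 ≤ N ∧
      (algBorderRank (kroneckerPow (J l) N) : ℝ) ≤ (2 * (l : ℝ) + 1 + δ) ^ N) →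
    Summit.MatrixMultiplication.MatrixMultiplication.Theses.NonabelianARC.JLadderHigherFlat := by
  intro hlow hdecay
  unfold Summit.MatrixMultiplication.MatrixMultiplication.Theses.NonabelianARC.JLadderHigherFlat
  intro J' l hl
  show asymptoticRank (J l) = 2 * (l : ℝ) + 1
  exact le_antisymm
    (asymptoticRank_le_of_borderPowerDecay (J l) (by positivity) (hdecay l hl)) (hlow l hl)

end Summit.MatrixMultiplication.MatrixMultiplication.Cruxes.NAARCLadder.JLadderHigherFlatBirth

end
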